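import Mathlib.CategoryTheory.Endomorphism
import Mathlib.CategoryTheory.MorphismProperty.Basic
import Mathlib.CategoryTheory.ObjectProperty.FullSubcategory
import Mathlib.Algebra.Group.Subgroup.Basic
import Mathlib.Data.PNat.Basic
import Mathlib.Data.Nat.Prime.Basic
import Literature.AlgebraicGeometry.Frobenioids.Monoids
import Literature.AlgebraicGeometry.Frobenioids.Categories
import HarnessLib

/-!
# Frobenioids I: the operations `(Base, Div, deg_Fr)` of a pre-Frobenioid and the typology of
# Definition 1.2, as the signature the category-theoreticity theorems of §3–§4 speak about

Mochizuki, *The geometry of Frobenioids I: the general theory*, Kyushu J. Math. **62** (2008)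
293–400 [cite: MochizukiFrdI2008, Def. 1.1 (iv) p.20, Rem. 1.1.1 p.21, Def. 1.2 pp.21-23].

**What this file is (INTERFACE, `TODO-merge: abc-iut-found`).** Definition 1.1 (iv) (p. 20) says that
a pre-Frobenioid structure `C → F_Φ` "restricts to" three operations on `C`: the projection `Base(-)`
to the base category `D`, the zero divisor `Div(φ) ∈ Φ(Base A)` and the Frobenius degree
`deg_Fr(φ) ∈ N_{≥1}`, subject to the composition rules of Remark 1.1.1 (p. 21). `PreFrobenioidData`
records exactly these operations and rules (the divisor monoid `Φ` as a `CommMonoid`-valued family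
with pull-back maps `α^*`, written multiplicatively as in `Monoids.lean`). Every notion of
Definition 1.2 that the statements of §3 (Thm. 3.4), §4 (Thm. 4.2, 4.9, Cor. 4.10–4.12) and §6
(Thm. 6.4) quantify over is then DEFINED from the operations, verbatim from pp. 21–23, in the
namespace `PreFrobenioidData` (dot notation), so that "`Ψ` preserves pre-steps" etc. are actual
statements about actual classes of arrows.

The cell's definition files for Def. 1.1–1.3 (the elementary Frobenioid `F_Φ` as a Lean category,
pre-Frobenioid structures as functors `C ⥤ F_Φ`, the 26-field `Frobenioid` structure; seat
abc-iut-found, proposals p402423 + successors) are the intended SOURCE of this data: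
`TODO-merge: abc-iut-found` — a functor `C ⥤ F_Φ` yields a `PreFrobenioidData` by reading off
`(Base, Div, deg_Fr)` (Remark 1.1.1 supplies the four laws), and the predicates below are then
literally those of Def. 1.2; this file neither defines `F_Φ` nor the Frobenioid axioms of Def. 1.3
and does not replace those files. Names live under `PreFrobenioidData.` to keep the top-level
namespace free for them.

Not here: Def. 1.3 (Frobenioids), the functors `Φ^gp`, `Φ^pf` on `D`, the constructions `C^istr`
(as a functor), `C^pf`, `C^birat`, `C^rlf` of §1–§5. No statement of the paper is strengthened.
-/

namespace Literature.AlgebraicGeometry.Frobenioids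

open CategoryTheory

universe w v v' u u'

/-- The operations of a pre-Frobenioid (FrdI Def. 1.1 (iv) p. 20 with the laws of Remark 1.1.1
p. 21): a category `C` over a base category `D` (`Base(-)` = `base`), a divisor monoid `Φ` on `D`
given by commutative monoids `Φ(X)` (written multiplicatively) with pull-back morphisms
`α^* : Φ(X) → Φ(Y)` for `α : Y → X`, the zero divisor `Div(φ) ∈ Φ(Base A)` of `φ : A → B`, and the
Frobenius degree `deg_Fr(φ) ∈ N_{≥1}`. INTERFACE for the cell's Def. 1.1–1.3 files
(`TODO-merge: abc-iut-found`). [cite: MochizukiFrdI2008, Def. 1.1 (iv) p.20] -/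
structure PreFrobenioidData (C : Type u) [Category.{v} C] (D : Type u') [Category.{v'} D] where
  /-- the natural projection functor `C → D`, `A ↦ Base(A)`, `φ ↦ Base(φ)` -/
  base : C ⥤ D
  /-- the divisor monoid: `X ↦ Φ(X)` -/
  Mon : D → Type w
  [instMon : ∀ X, CommMonoid (Mon X)]
  /-- the pull-back morphism `α^* : Φ(X) → Φ(Y)` of `α : Y → X` (a contravariant functor) -/
  pull : ∀ {X Y : D}, (Y ⟶ X) → (Mon X →* Mon Y)
  /-- `(id)^* = id` -/
  pull_id : ∀ (X : D) (x : Mon X), pull (𝟙 X) x = x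
  /-- `(α ∘ β)^* = β^* ∘ α^*` -/
  pull_comp : ∀ {X Y Z : D} (β : Z ⟶ Y) (α : Y ⟶ X) (x : Mon X),
    pull (β ≫ α) x = pull β (pull α x)
  /-- the zero divisor `Div(φ) ∈ Φ(Base A)` of `φ : A → B` -/
  div : ∀ {A B : C}, (A ⟶ B) → Mon (base.obj A)
  /-- the Frobenius degree `deg_Fr(φ) ∈ N_{≥1}` -/
  degFr : ∀ {A B : C}, (A ⟶ B) → ℕ+
  /-- `Div(id) = 0` -/
  div_id : ∀ A : C, div (𝟙 A) = 1
  /-- Remark 1.1.1: `Div(φ ∘ ψ) = Base(ψ)^* Div(φ) + deg_Fr(φ) · Div(ψ)` (here `ψ ≫ φ`,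
  multiplicatively) -/
  div_comp : ∀ {A B B' : C} (ψ : A ⟶ B) (φ : B ⟶ B'),
    div (ψ ≫ φ) = pull (base.map ψ) (div φ) * div ψ ^ (degFr φ : ℕ)
  /-- `deg_Fr(id) = 1` -/
  degFr_id : ∀ A : C, degFr (𝟙 A) = 1
  /-- Remark 1.1.1: `deg_Fr(φ ∘ ψ) = deg_Fr(φ) · deg_Fr(ψ)` -/
  degFr_comp : ∀ {A B B' : C} (ψ : A ⟶ B) (φ : B ⟶ B'), degFr (ψ ≫ φ) = degFr ψ * degFr φ

namespace PreFrobenioidData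

/-- The divisor monoids `Φ(X)` of a `PreFrobenioidData` are commutative monoids (the structure-carried
instance, exposed). [cite: MochizukiFrdI2008, Def. 1.1 (iv) p.20] -/
instance instCommMonoidMon {C : Type u} [Category.{v} C] {D : Type u'} [Category.{v'} D]
    (S : PreFrobenioidData.{w} C D) (X : D) : CommMonoid (S.Mon X) := S.instMon X

variable {C : Type u} [Category.{v} C] {D : Type u'} [Category.{v'} D]
variable (S : PreFrobenioidData.{w} C D)

/-! ### Definition 1.2 (i), (ii): linear, isometric, base-isomorphisms, pull-back morphisms -/

/-- `φ` is *linear* if `deg_Fr(φ) = 1` (FrdI Def. 1.2 (i) p. 21). [cite: MochizukiFrdI2008, Def. 1.2 (i) p.21] -/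
def IsLinear : MorphismProperty C := fun _ _ φ => S.degFr φ = 1

/-- `φ` is *isometric* (an *isometry*) if `Div(φ) = 0` (FrdI Def. 1.2 (i) p. 21).
[cite: MochizukiFrdI2008, Def. 1.2 (i) p.21] -/
def IsIsometry : MorphismProperty C := fun _ _ φ => S.div φ = 1

/-- Co-objective `φ`, `ψ` are *metrically equivalent* if `Div(φ) = Div(ψ)` (FrdI Def. 1.2 (i) p. 21).
[cite: MochizukiFrdI2008, Def. 1.2 (i) p.21] -/
def MetricallyEquivalent {A B : C} (φ ψ : A ⟶ B) : Prop := S.div φ = S.div ψ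

/-- `φ` is a *base-isomorphism* if `Base(φ)` is an isomorphism of `D` (FrdI Def. 1.2 (ii) p. 21).
[cite: MochizukiFrdI2008, Def. 1.2 (ii) p.21] -/
def IsBaseIso : MorphismProperty C := fun _ _ φ => IsIso (S.base.map φ)

/-- `φ` is a *base-FSM-morphism* if `Base(φ)` is an FSM-morphism of `D` (FrdI Def. 1.2 (ii) p. 21).
[cite: MochizukiFrdI2008, Def. 1.2 (ii) p.21] -/
def IsBaseFSM : MorphismProperty C := fun _ _ φ => IsFSM (S.base.map φ)

/-- Objects `A`, `B` are *base-isomorphic* if `Base(A) ≅ Base(B)` in `D` (FrdI Def. 1.2 (ii) p. 21).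
[cite: MochizukiFrdI2008, Def. 1.2 (ii) p.21] -/
def BaseIsomorphic (A B : C) : Prop := Nonempty (S.base.obj A ≅ S.base.obj B)

/-- `φ : A → B` is a *pull-back morphism* if the natural transformation
`Hom_C(-, A) → Hom_C(-, B) ×_{Hom_D(-, Base B)} Hom_D(-, Base A)` induced by `φ` is an isomorphism,
i.e. every pair `(χ : X → B, β : Base X → Base A)` with `Base(χ) = Base(φ) ∘ β` comes from a unique
`ψ : X → A` (FrdI Def. 1.2 (ii) p. 21). [cite: MochizukiFrdI2008, Def. 1.2 (ii) p.21] -/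
def IsPullbackMorphism : MorphismProperty C := fun A B φ =>
  ∀ ⦃X : C⦄ (χ : X ⟶ B) (β : S.base.obj X ⟶ S.base.obj A), β ≫ S.base.map φ = S.base.map χ →
    ∃! ψ : X ⟶ A, ψ ≫ φ = χ ∧ S.base.map ψ = β

/-- Co-objective `φ`, `ψ` are *base-equivalent* if `Base(φ) = Base(ψ)` (FrdI Def. 1.2 (ii) p. 21).
[cite: MochizukiFrdI2008, Def. 1.2 (ii) p.21] -/
def BaseEquivalent {A B : C} (φ ψ : A ⟶ B) : Prop := S.base.map φ = S.base.map ψ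

/-- Co-objective `φ`, `ψ` are *Div-equivalent* if `Φ(φ) = Φ(ψ)`, i.e. the induced pull-back maps of
divisor monoids agree (FrdI Def. 1.2 (ii) p. 21). [cite: MochizukiFrdI2008, Def. 1.2 (ii) p.21] -/
def DivEquivalent {A B : C} (φ ψ : A ⟶ B) : Prop := S.pull (S.base.map φ) = S.pull (S.base.map ψ)

/-- An endomorphism is a *base-identity* endomorphism if `Base(φ) = id` (FrdI Def. 1.2 (ii)
pp. 21–22). [cite: MochizukiFrdI2008, Def. 1.2 (ii) p.21] -/
def IsBaseIdentity {A : C} (φ : A ⟶ A) : Prop := S.base.map φ = 𝟙 _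

/-- An endomorphism is a *Div-identity* endomorphism if `Φ(φ) = Φ(id)`, i.e. it acts trivially on
`Φ(Base A)` (FrdI Def. 1.2 (ii) p. 22). [cite: MochizukiFrdI2008, Def. 1.2 (ii) p.22] -/
def IsDivIdentity {A : C} (φ : A ⟶ A) : Prop := ∀ x, S.pull (S.base.map φ) x = x

/-- Degrees of composable arrows multiply, in `End A` (whose multiplication is composition).
[cite: MochizukiFrdI2008, Rem. 1.1.1 p.21] -/
theorem degFr_mul {A : C} (f g : End A) : S.degFr (f * g) = S.degFr g * S.degFr f := by
  rw [End.mul_def, S.degFr_comp]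

/-- `O^▷(A) ⊆ End_C(A)`: the submonoid of base-identity linear endomorphisms (FrdI Def. 1.2 (ii)
p. 22). [cite: MochizukiFrdI2008, Def. 1.2 (ii) p.22] -/
def endSubmonoid (A : C) : Submonoid (End A) where
  carrier := {φ | S.IsBaseIdentity φ ∧ S.IsLinear φ}
  one_mem' := ⟨S.base.map_id A, S.degFr_id A⟩
  mul_mem' := by
    rintro f g ⟨hf, hf'⟩ ⟨hg, hg'⟩
    refine ⟨?_, ?_⟩
    · show S.base.map (g ≫ f) = 𝟙 _
      rw [S.base.map_comp, hg, hf, Category.id_comp]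
    · show S.degFr (g ≫ f) = 1
      rw [S.degFr_comp, hg', hf', mul_one]

/-- `O^×(A) ⊆ Aut_C(A)`: the subgroup of base-identity linear automorphisms (FrdI Def. 1.2 (ii)
p. 22). [cite: MochizukiFrdI2008, Def. 1.2 (ii) p.22] -/
def unitsSubgroup (A : C) : Subgroup (Aut A) where
  carrier := {α | S.IsBaseIdentity α.hom ∧ S.IsLinear α.hom}
  one_mem' := ⟨S.base.map_id A, S.degFr_id A⟩
  mul_mem' := by
    rintro f g ⟨hf, hf'⟩ ⟨hg, hg'⟩
    refine ⟨?_, ?_⟩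
    · show S.base.map (g.hom ≫ f.hom) = 𝟙 _
      rw [S.base.map_comp, hg, hf, Category.id_comp]
    · show S.degFr (g.hom ≫ f.hom) = 1
      rw [S.degFr_comp, hg', hf', mul_one]
  inv_mem' := by
    rintro f ⟨hf, hf'⟩
    refine ⟨?_, ?_⟩
    · show S.base.map f.inv = 𝟙 _
      rw [← S.base.mapIso_inv f, ← (S.base.mapIso f).inv_hom_id, S.base.mapIso_hom, hf,
        Category.comp_id]
    · show S.degFr f.inv = 1
      have h := S.degFr_comp f.hom f.inv
      rw [f.hom_inv_id, S.degFr_id, hf', one_mul] at h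
      exact h.symm

/-! ### Definition 1.2 (iii): pre-steps, co-angular, LB-invertible, Frobenius type -/

/-- `φ` is a *pre-step* if it is a linear base-isomorphism (FrdI Def. 1.2 (iii) p. 22).
[cite: MochizukiFrdI2008, Def. 1.2 (iii) p.22] -/
def IsPreStep : MorphismProperty C := fun _ _ φ => S.IsLinear φ ∧ S.IsBaseIso φ

/-- A pre-step is a *step* if it is not an isomorphism (FrdI Def. 1.2 (iii) p. 22).
[cite: MochizukiFrdI2008, Def. 1.2 (iii) p.22] -/
def IsStep : MorphismProperty C := fun _ _ φ => S.IsPreStep φ ∧ ¬ IsIso φ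

/-- A pre-step is *primary* if `Div(φ)` is a primary element of `Φ(A)` (FrdI Def. 1.2 (iii) p. 22).
[cite: MochizukiFrdI2008, Def. 1.2 (iii) p.22] -/
def IsPrimaryPreStep : MorphismProperty C := fun _ _ φ => S.IsPreStep φ ∧ IsPrimary (S.div φ)

/-- An *isometric pre-step*. [cite: MochizukiFrdI2008, Def. 1.2 (iii) p.22] -/
def IsIsometricPreStep : MorphismProperty C := fun _ _ φ => S.IsPreStep φ ∧ S.IsIsometry φ

/-- `φ` is *co-angular* if in every factorisation `φ = α ∘ β ∘ γ` with `α` linear, `β` an isometric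
pre-step and `α` or `γ` a base-isomorphism, `β` is an isomorphism (FrdI Def. 1.2 (iii) p. 22).
[cite: MochizukiFrdI2008, Def. 1.2 (iii) p.22] -/
def IsCoAngular : MorphismProperty C := fun A B φ =>
  ∀ ⦃X Y : C⦄ (γ : A ⟶ X) (β : X ⟶ Y) (α : Y ⟶ B), γ ≫ β ≫ α = φ → S.IsLinear α →
    S.IsIsometricPreStep β → (S.IsBaseIso α ∨ S.IsBaseIso γ) → IsIso β

/-- `φ` is *LB-invertible* if it is co-angular and isometric (FrdI Def. 1.2 (iii) p. 22).
[cite: MochizukiFrdI2008, Def. 1.2 (iii) p.22] -/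
def IsLBInvertible : MorphismProperty C := fun _ _ φ => S.IsCoAngular φ ∧ S.IsIsometry φ

/-- `φ` is *of Frobenius type* if it is an LB-invertible base-isomorphism (FrdI Def. 1.2 (iii)
p. 22). [cite: MochizukiFrdI2008, Def. 1.2 (iii) p.22] -/
def IsFrobeniusType : MorphismProperty C := fun _ _ φ => S.IsLBInvertible φ ∧ S.IsBaseIso φ

/-- `φ` is a *prime-Frobenius morphism* if it is of Frobenius type of prime Frobenius degree
(FrdI Def. 1.2 (iii) p. 22). [cite: MochizukiFrdI2008, Def. 1.2 (iii) p.22] -/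
def IsPrimeFrobenius : MorphismProperty C := fun _ _ φ =>
  S.IsFrobeniusType φ ∧ Nat.Prime (S.degFr φ : ℕ)

/-- A *co-angular pre-step* (the arrows of `C^coa-pre`, Def. 1.3 (iii)(d)).
[cite: MochizukiFrdI2008, Def. 1.2 (iii) p.22] -/
def IsCoAngularPreStep : MorphismProperty C := fun _ _ φ => S.IsCoAngular φ ∧ S.IsPreStep φ

/-- The arrows *of Frobenius degree `d`*. [cite: MochizukiFrdI2008, Def. 1.2 (iii) p.22] -/
def HasDegree (d : ℕ+) : MorphismProperty C := fun _ _ φ => S.degFr φ = d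

/-! ### Definition 1.2 (iv): types of objects -/

/-- `A` is *Frobenius-trivial*: there is a homomorphism `ζ : N_{≥1} → End_C(A)`, a section of the
Frobenius degree, whose values are base-identity endomorphisms of Frobenius type (FrdI Def. 1.2 (iv)
p. 22). [cite: MochizukiFrdI2008, Def. 1.2 (iv) p.22] -/
def IsFrobeniusTrivial (A : C) : Prop :=
  ∃ ζ : ℕ+ →* End A, ∀ n, S.degFr (ζ n) = n ∧ S.IsBaseIdentity (ζ n) ∧ S.IsFrobeniusType (ζ n)

/-- `A` is *Div-Frobenius-trivial*: the same with Div-identity endomorphisms of Frobenius type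
(FrdI Def. 1.2 (iv) p. 22). [cite: MochizukiFrdI2008, Def. 1.2 (iv) p.22] -/
def IsDivFrobeniusTrivial (A : C) : Prop :=
  ∃ ζ : ℕ+ →* End A, ∀ n, S.degFr (ζ n) = n ∧ S.IsDivIdentity (ζ n) ∧ S.IsFrobeniusType (ζ n)

/-- `A` is *universally Div-Frobenius-trivial*: every pull-back morphism `A' → A` has
Div-Frobenius-trivial domain (FrdI Def. 1.2 (iv) p. 22). [cite: MochizukiFrdI2008, Def. 1.2 (iv) p.22] -/
def IsUniversallyDivFrobeniusTrivial (A : C) : Prop :=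
  ∀ ⦃A' : C⦄ (φ : A' ⟶ A), S.IsPullbackMorphism φ → S.IsDivFrobeniusTrivial A'

/-- `A` is *base-trivial*: every object base-isomorphic to `A` is isomorphic to `A`
(FrdI Def. 1.2 (iv) p. 23). [cite: MochizukiFrdI2008, Def. 1.2 (iv) p.23] -/
def IsBaseTrivial (A : C) : Prop := ∀ B : C, S.BaseIsomorphic A B → Nonempty (A ≅ B)

/-- `A` is *`Aut`-ample*: `Aut_C(A) → Aut_D(Base A)` is surjective (FrdI Def. 1.2 (iv) p. 23).
[cite: MochizukiFrdI2008, Def. 1.2 (iv) p.23] -/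
def IsAutAmple (A : C) : Prop := ∀ β : S.base.obj A ≅ S.base.obj A, ∃ α : A ≅ A, S.base.mapIso α = β

/-- `A` is *`End`-ample*: `End_C(A) → End_D(Base A)` is surjective (FrdI Def. 1.2 (iv) p. 23).
[cite: MochizukiFrdI2008, Def. 1.2 (iv) p.23] -/
def IsEndAmple (A : C) : Prop := ∀ β : S.base.obj A ⟶ S.base.obj A, ∃ α : A ⟶ A, S.base.map α = β

/-- `A` is *perfect*: for every `n`, every object base-isomorphic to `A` is the codomain of a
morphism of Frobenius type of degree `n`, and pre-steps lift uniquely along pairs of such morphisms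
(FrdI Def. 1.2 (iv) p. 23). [cite: MochizukiFrdI2008, Def. 1.2 (iv) p.23] -/
def IsPerfectObj (A : C) : Prop :=
  ∀ n : ℕ+,
    (∀ B : C, S.BaseIsomorphic B A → ∃ (B₀ : C) (φ : B₀ ⟶ B), S.IsFrobeniusType φ ∧ S.degFr φ = n) ∧
    ∀ ⦃B₁ B₁' B₂ B₂' : C⦄ (φ₁ : B₁ ⟶ B₁') (φ₂ : B₂ ⟶ B₂'), S.BaseIsomorphic B₁ A →
      S.BaseIsomorphic B₂ A → S.IsFrobeniusType φ₁ → S.degFr φ₁ = n → S.IsFrobeniusType φ₂ →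
      S.degFr φ₂ = n → ∀ ψ' : B₁' ⟶ B₂', S.IsPreStep ψ' →
        ∃! ψ : B₁ ⟶ B₂, S.IsPreStep ψ ∧ ψ ≫ φ₂ = φ₁ ≫ ψ'

/-- `A` is *group-like*: `Φ(A) = 0` (FrdI Def. 1.2 (iv) p. 23). [cite: MochizukiFrdI2008, Def. 1.2 (iv) p.23] -/
def IsGroupLikeObj (A : C) : Prop := ∀ x : S.Mon (S.base.obj A), x = 1

/-- `A` is *Frobenius-compact*: `O^×(A)` is commutative, `O^×(A)^pf ≠ 0`, and every automorphism of
`A` that acts (by conjugation) on `O^×(A)^pf` by multiplication by some `λ = p/q ∈ ℚ_{>0}` acts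
trivially on `O^×(A)^pf` (FrdI Def. 1.2 (iv) p. 23). The three conditions on the perfection are
unwound through `M → M^pf` (`Monoids.lean`: `of a = of b ↔ ∃ N, a^N = b^N`): "`≠ 0`" = some unit is
non-torsion; "acts by `p/q`" = `∀ u, ∃ N, ((f u f⁻¹)^q)^N = (u^p)^N`; "acts trivially" =
`∀ u, ∃ N, (f u f⁻¹)^N = u^N`. [cite: MochizukiFrdI2008, Def. 1.2 (iv) p.23] -/
def IsFrobeniusCompact (A : C) : Prop :=
  (∀ u ∈ S.unitsSubgroup A, ∀ u' ∈ S.unitsSubgroup A, u * u' = u' * u) ∧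
    (∃ u ∈ S.unitsSubgroup A, ∀ N : ℕ, 0 < N → u ^ N ≠ 1) ∧
    ∀ (f : Aut A) (p q : ℕ+),
      (∀ u ∈ S.unitsSubgroup A, ∃ N : ℕ, 0 < N ∧ ((f * u * f⁻¹) ^ (q : ℕ)) ^ N = (u ^ (p : ℕ)) ^ N) →
        ∀ u ∈ S.unitsSubgroup A, ∃ N : ℕ, 0 < N ∧ (f * u * f⁻¹) ^ N = u ^ N

/-- `A` is *Frobenius-normalized*: a base-identity endomorphism `φ` of degree `d` and `α ∈ O^▷(A)`
satisfy `α^d ∘ φ = φ ∘ α` (FrdI Def. 1.2 (iv) p. 23; in `End A`, `x * y = y ≫ x`).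
[cite: MochizukiFrdI2008, Def. 1.2 (iv) p.23] -/
def IsFrobeniusNormalized (A : C) : Prop :=
  ∀ (φ : End A), S.IsBaseIdentity φ → ∀ α ∈ S.endSubmonoid A, α ^ (S.degFr φ : ℕ) * φ = φ * α

/-- `A` is *unit-trivial*: `O^×(A) = {1}` (FrdI Def. 1.2 (iv) p. 23). [cite: MochizukiFrdI2008, Def. 1.2 (iv) p.23] -/
def IsUnitTrivial (A : C) : Prop := S.unitsSubgroup A = ⊥

/-- `A` is *isotropic*: every isometric pre-step `A → B` is an isomorphism (FrdI Def. 1.2 (iv)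
p. 23). [cite: MochizukiFrdI2008, Def. 1.2 (iv) p.23] -/
def IsIsotropic (A : C) : Prop := ∀ ⦃B : C⦄ (φ : A ⟶ B), S.IsIsometricPreStep φ → IsIso φ

/-- `φ : A → B` is an *isotropic hull* of `A`: an isometric pre-step to an isotropic object through
which every arrow from `A` to an isotropic object factors uniquely (FrdI Def. 1.2 (iv) p. 23).
[cite: MochizukiFrdI2008, Def. 1.2 (iv) p.23] -/
def IsIsotropicHull : MorphismProperty C := fun A B φ =>
  S.IsIsometricPreStep φ ∧ S.IsIsotropic B ∧
    ∀ ⦃X : C⦄ (γ : A ⟶ X), S.IsIsotropic X → ∃! β : B ⟶ X, φ ≫ β = γ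

/-- `A` is *Frobenius-isotropic*: some morphism of Frobenius type `A → B` has isotropic codomain
(FrdI Def. 1.2 (iv) p. 23). [cite: MochizukiFrdI2008, Def. 1.2 (iv) p.23] -/
def IsFrobeniusIsotropic (A : C) : Prop :=
  ∃ (B : C) (φ : A ⟶ B), S.IsFrobeniusType φ ∧ S.IsIsotropic B

/-- "Isotropic" as an object property, cutting out `C^istr`. [cite: MochizukiFrdI2008, Def. 1.2 (iv) p.23] -/
def isotropicObjects : ObjectProperty C := fun A => S.IsIsotropic A

/-- `C^istr ⊆ C`, the full subcategory of isotropic objects (FrdI Def. 1.2 (iv) p. 23).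
[cite: MochizukiFrdI2008, Def. 1.2 (iv) p.23] -/
abbrev Istr : Type u := S.isotropicObjects.FullSubcategory

/-- The inclusion `C^istr ⥤ C`. [cite: MochizukiFrdI2008, Def. 1.2 (iv) p.23] -/
abbrev istrι : S.Istr ⥤ C := S.isotropicObjects.ι

/-! ### Definition 1.2 (v): types of pre-Frobenioids -/

/-- `C` is *of isotropic type*: every object is isotropic (FrdI Def. 1.2 (v) p. 23).
[cite: MochizukiFrdI2008, Def. 1.2 (v) p.23] -/
@[mk_iff] structure IsOfIsotropicType : Prop where
  /-- every object is isotropic -/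
  obj : ∀ A : C, S.IsIsotropic A

/-- `C` is *of Frobenius-isotropic type* (FrdI Def. 1.2 (v) p. 23). [cite: MochizukiFrdI2008, Def. 1.2 (v) p.23] -/
@[mk_iff] structure IsOfFrobeniusIsotropicType : Prop where
  /-- every object is Frobenius-isotropic -/
  obj : ∀ A : C, S.IsFrobeniusIsotropic A

/-- `C` is *of group-like type* (FrdI Def. 1.2 (v) p. 23). [cite: MochizukiFrdI2008, Def. 1.2 (v) p.23] -/
@[mk_iff] structure IsOfGroupLikeType : Prop where
  /-- every object is group-like -/
  obj : ∀ A : C, S.IsGroupLikeObj A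

/-- `C` is *of Frobenius-normalized type* (FrdI Def. 1.2 (v) p. 23). [cite: MochizukiFrdI2008, Def. 1.2 (v) p.23] -/
@[mk_iff] structure IsOfFrobeniusNormalizedType : Prop where
  /-- every object is Frobenius-normalized -/
  obj : ∀ A : C, S.IsFrobeniusNormalized A

/-- `C` is *of unit-trivial type* (FrdI Def. 1.2 (v) p. 23). [cite: MochizukiFrdI2008, Def. 1.2 (v) p.23] -/
@[mk_iff] structure IsOfUnitTrivialType : Prop where
  /-- every object is unit-trivial -/
  obj : ∀ A : C, S.IsUnitTrivial A

/-- `C` is *of base-trivial type* (FrdI Def. 1.2 (v) p. 23). [cite: MochizukiFrdI2008, Def. 1.2 (v) p.23] -/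
@[mk_iff] structure IsOfBaseTrivialType : Prop where
  /-- every object is base-trivial -/
  obj : ∀ A : C, S.IsBaseTrivial A

/-- `C` is *of `Aut`-ample type* (FrdI Def. 1.2 (v) p. 23). [cite: MochizukiFrdI2008, Def. 1.2 (v) p.23] -/
@[mk_iff] structure IsOfAutAmpleType : Prop where
  /-- every object is `Aut`-ample -/
  obj : ∀ A : C, S.IsAutAmple A

/-- `C` is *of perfect type* (FrdI Def. 1.2 (v) p. 23). [cite: MochizukiFrdI2008, Def. 1.2 (v) p.23] -/
@[mk_iff] structure IsOfPerfectType : Prop where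
  /-- every object is perfect -/
  obj : ∀ A : C, S.IsPerfectObj A

/-- `C` is *of Frobenius-trivial type* (FrdI Def. 1.2 (v) p. 23). [cite: MochizukiFrdI2008, Def. 1.2 (v) p.23] -/
@[mk_iff] structure IsOfFrobeniusTrivialType : Prop where
  /-- every object is Frobenius-trivial -/
  obj : ∀ A : C, S.IsFrobeniusTrivial A

/-! ### Definition 1.1 (i), (ii): non-dilating endomorphisms of the divisor monoid -/

/-- An endomorphism `α` of a (pre-divisorial) monoid `M` is *non-dilating* if the induced
endomorphism `α^char` of `M^char` is the identity whenever `α^char(a) ≼ a` for all primary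
`a ∈ M^char` (FrdI Def. 1.1 (i) p. 19; `M^char = Associates M`, `≼ = Precsim` as in `Monoids.lean`).
[cite: MochizukiFrdI2008, Def. 1.1 (i) p.19] -/
def IsNonDilating {M : Type w} [CommMonoid M] (α : M →* M) : Prop :=
  (∀ a : Associates M, IsPrimary a → Precsim (associatesMap α a) a) → ∀ a, associatesMap α a = a

/-- The divisor monoid `Φ` is *non-dilating* if every endomorphism of `Φ(X)` induced by an
endomorphism of `X ∈ Ob(D)` is non-dilating (FrdI Def. 1.1 (ii) p. 19).
[cite: MochizukiFrdI2008, Def. 1.1 (ii) p.19] -/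
@[mk_iff] structure IsNonDilatingOn : Prop where
  /-- endomorphisms of `D` pull back to non-dilating endomorphisms -/
  nonDilating : ∀ (X : D) (f : X ⟶ X), IsNonDilating (S.pull f)

/-! ### "`Ψ` preserves …" (§3): the transport vocabulary -/

section Preserves

variable {C₁ : Type u} [Category.{v} C₁] {C₂ : Type u'} [Category.{v'} C₂]

/-- A functor `Ψ` *preserves* a class of arrows: it maps arrows of the class `P₁` to arrows of the
class `P₂` (the usage of "`Ψ` preserves pre-steps, …" in FrdI §3, e.g. Thm. 3.4).
[cite: MochizukiFrdI2008, Thm. 3.4 p.62] -/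
def PreservesMor (Ψ : C₁ ⥤ C₂) (P₁ : MorphismProperty C₁) (P₂ : MorphismProperty C₂) : Prop :=
  ∀ ⦃A B : C₁⦄ (φ : A ⟶ B), P₁ φ → P₂ (Ψ.map φ)

/-- A functor `Ψ` *preserves* a class of objects (FrdI §3, e.g. "`Ψ` preserves the isotropic
objects", Thm. 3.4 (i)). [cite: MochizukiFrdI2008, Thm. 3.4 (i) p.62] -/
def PreservesObj (Ψ : C₁ ⥤ C₂) (P₁ : C₁ → Prop) (P₂ : C₂ → Prop) : Prop :=
  ∀ ⦃A : C₁⦄, P₁ A → P₂ (Ψ.obj A)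

/-- A functor *preserves a relation* on co-objective pairs of arrows (e.g. "base-equivalent pairs",
Thm. 3.4 (v)). [cite: MochizukiFrdI2008, Thm. 3.4 (v) p.63] -/
def PreservesRel (Ψ : C₁ ⥤ C₂) (R₁ : ∀ ⦃A B : C₁⦄, (A ⟶ B) → (A ⟶ B) → Prop)
    (R₂ : ∀ ⦃A B : C₂⦄, (A ⟶ B) → (A ⟶ B) → Prop) : Prop :=
  ∀ ⦃A B : C₁⦄ (φ ψ : A ⟶ B), R₁ φ ψ → R₂ (Ψ.map φ) (Ψ.map ψ)

end Preserves

end PreFrobenioidData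

end Literature.AlgebraicGeometry.Frobenioids
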